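import Literature.Computability.Complexity.CircuitLowerBounds
import Literature.Computability.Complexity.NWQuickPRG
import Literature.Computability.Complexity.HardLangMachine
import Literature.Computability.Complexity.IWStrongHardness
import Literature.Computability.Complexity.IWStrongMachine
import Literature.Computability.Complexity.ProbabilisticClassesProofs
import HarnessLib

/-!
# `impagliazzo_wigderson` (pnp.S24): `P = BPP` from hard languages in `E` — DISCHARGED

Sibling of `CircuitLowerBounds.lean` for the named fact `impagliazzo_wigderson`
(Impagliazzo–Wigderson 1997, Thm. 2: if some `L ∈ E` has circuit complexity `2^{Ω(n)}` almost
everywhere then `P = BPP`), ending with the closed discharge **`impagliazzo_wigderson_holds`**.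
The printed proof is the chain

  worst-case `2^{Ω(n)}`-hard `L ∈ E`
    ⟹ (IW97 Thm. 1 "derandomizing the XOR lemma" = Arora–Barak 2009, Thm. 19.27)
  average-case `2^{Ω(n)}`-hard `L' ∈ E`
    ⟹ (Nisan–Wigderson 1994 = Arora–Barak Thm. 20.6: quick PRG, `NWQuickPRG.lean`)
    ⟹ (Yao / Arora–Barak Lemma 20.3: `PRGDerandomization.lean`)
  `BPP ⊆ P`, and `P ⊆ BPP` (`P_subset_BPP_holds`).

Every link is proved in the tree; this file assembles them:

* `P_eq_BPP_of_avgHard_E` — **Nisan–Wigderson's `BPP = P`** (Nisan–Wigderson 1994, Thm. 3 (1);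
  Arora–Barak 2009, Thm. 20.6 with Cor. 20.4 (1) in the average-case form of Thm. 20.7 (1)): if some
  `L ∈ E` and `ε > 0` have `H_avg(L ∩ {0,1}ⁿ) ≥ 2^{εn}` for all large `n` (`AvgHardAtLeast`,
  Arora–Barak Def. 19.1), then `P = BPP`;
* `impagliazzo_wigderson_of_hardnessAmplification` — the named fact follows from hardness
  amplification inside `E` (worst-case `2^{εn}` almost everywhere ⟹ average-case `2^{ε'n}` almost
  everywhere; Impagliazzo–Wigderson 1997, Thm. 1), stated as an explicit hypothesis. That
  hypothesis is NOT vendored as a named fact (D-0026); it is the remaining obligation of the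
  discharge `impagliazzo_wigderson_holds`;
* `impagliazzo_wigderson_of_mildToStrong` — with the first step of the amplification now in the
  tree (`HardLangM.exists_mildHard_E`: worst-case `2^{εn}` a.e. in `E` ⟹ MILD average-case hardness
  a.e. in `E`, Babai–Fortnow–Nisan–Wigderson 1993 / Arora–Barak Thm. 19.21 in the very mild regime,
  `WorstCaseToMild.lean` + `MildHardLanguage.lean` + `HardLangMachine.lean`), the remaining
  obligation is exactly MILD-TO-STRONG amplification inside `E` with linearly related input length
  (Impagliazzo–Wigderson 1997, Thm. 1 proper: hard-core sets + the derandomized direct-product /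
  XOR lemma; Goldreich 2008, Lemmas 7.22–7.23), stated as the explicit hypothesis;
* **`impagliazzo_wigderson_holds`** — the discharge: the mild-to-strong step is
  `IWStrong.avgHard_strongLang` (`IWStrongHardness.lean`: the strongly hard language
  `IWStrong.strongLang q L₁` of `IWStrongLanguage.lean`, whose slices are the Impagliazzo–Wigderson /
  Healy–Vadhan–Viola code `Amp` of the slices of `L₁` with `2^{O(N)}` blocks over greedy design words
  and the Hankel pairwise hitter, decoded by the tree's derandomized XOR lemma
  `IWAmp.exists_majority_advPred` — Hirahara 2022, Lemma 8.1 — in circuit form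
  `IWAmpBridge.exists_circuit_of_agree`) together with `IWStrongM.strongLang_mem_E`
  (`IWStrongMachine.lean`: the language is in `E`), at `q = ⌈64/ε₁⌉₊ + 1`.

## References

* R. Impagliazzo, A. Wigderson, *P = BPP if E requires exponential circuits: derandomizing the XOR
  lemma*, STOC 1997, 220–229, Thms. 1–2 [ImpagliazzoWigderson1997].
* N. Nisan, A. Wigderson, *Hardness vs randomness*, JCSS 49 (1994) 149–167, Thm. 3 (1)
  [NisanWigderson1994].
* S. Arora, B. Barak, *Computational Complexity: A Modern Approach*, CUP 2009, Thm. 19.21, Thm. 19.27,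
  Thm. 20.6, Thm. 20.7 (1), Cor. 20.4 (1) [AroraBarakCC2009].
* O. Goldreich, *Computational Complexity: A Conceptual Perspective*, CUP 2008, §7.2.2 (Thm. 7.21,
  Lemmas 7.22–7.23: the Impagliazzo–Wigderson chain via hard regions).
-/

namespace Literature.Computability.Complexity

open Filter MetaComplexity

/-- **Nisan–Wigderson: `P = BPP` if `E` has a language that is `2^{Ω(n)}`-hard on average almost
everywhere** (Nisan–Wigderson 1994, Thm. 3 (1): "If there is a function computable in `E` that
cannot be approximated by circuits of size `2^{εn}` for some `ε > 0` … then `BPP = P`";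
Arora–Barak 2009, Thm. 20.6 + Cor. 20.4 (1)). `BPP ⊆ P` is `BPP_subset_P_of_avgHard_E`
(`NWQuickPRG.lean`), `P ⊆ BPP` is `P_subset_BPP_holds`. [cite: NisanWigderson1994, Thm. 3 (1)]
[cite: AroraBarakCC2009, Thm. 20.6 and Cor. 20.4 (1)] -/
theorem P_eq_BPP_of_avgHard_E
    (h : ∃ L ∈ E, ∃ ε : ℝ, 0 < ε ∧ ∀ᶠ n : ℕ in atTop, AvgHardAtLeast (L.sliceFn n) ((2 : ℝ) ^ (ε * n))) :
    Classes.P = BPP := by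
  obtain ⟨L, hL, ε, hε, hhard⟩ := h
  exact Set.Subset.antisymm P_subset_BPP_holds (BPP_subset_P_of_avgHard_E hL hε hhard)

/-- **`impagliazzo_wigderson` from hardness amplification in `E`**: if worst-case hardness
`2^{εn} ≤ L.circuitSize n` for all large `n` of some `L ∈ E` yields some `L' ∈ E` that is
`2^{ε'n}`-hard on average for all large `n` (Impagliazzo–Wigderson 1997, Thm. 1 = Arora–Barak
2009, Thm. 19.27, the link not yet in the tree), then `P = BPP` under the hypothesis of the named
fact (by `P_eq_BPP_of_avgHard_E`). The amplification is an explicit hypothesis here, not a named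
fact. [cite: ImpagliazzoWigderson1997, Thms. 1–2] [cite: AroraBarakCC2009, Thm. 20.7 (1)] -/
theorem impagliazzo_wigderson_of_hardnessAmplification
    (hamp : (∃ L ∈ E, ∃ ε : ℝ, 0 < ε ∧ ∀ᶠ n : ℕ in atTop, (2 : ℝ) ^ (ε * n) ≤ (L.circuitSize n : ℝ)) →
      ∃ L' ∈ E, ∃ ε' : ℝ, 0 < ε' ∧
        ∀ᶠ n : ℕ in atTop, AvgHardAtLeast (L'.sliceFn n) ((2 : ℝ) ^ (ε' * n))) :
    impagliazzo_wigderson :=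
  fun hE => P_eq_BPP_of_avgHard_E (hamp hE)

/-- **`impagliazzo_wigderson` from mild-to-strong amplification in `E`.** The tree proves the first
step of Impagliazzo–Wigderson's chain (`HardLangM.exists_mildHard_E`, Arora–Barak Thm. 19.21 in the
very mild regime: some `L₁ ∈ E` such that, for all large `m`, every `B₂`-circuit of size
`≤ 2^{εm/16}` errs on at least `2ᵐ/m⁶` inputs of length `m`); what remains is the amplification of
this MILD average-case hardness to STRONG average-case hardness `H_avg ≥ 2^{ε'n}` almost everywhere
inside `E` (Impagliazzo–Wigderson 1997, Thm. 1: hard-core sets and the derandomized XOR lemma with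
linearly related input length; Goldreich 2008, Thm. 7.21 and Lemmas 7.22–7.23), stated here as the
explicit hypothesis `hmild` (not a named fact, D-0026). [cite: ImpagliazzoWigderson1997, Thms. 1–2]
[cite: AroraBarakCC2009, Thm. 19.21 and Thm. 20.7 (1)] -/
theorem impagliazzo_wigderson_of_mildToStrong
    (hmild : (∃ L₁ ∈ E, ∃ ε : ℝ, 0 < ε ∧ ∀ᶠ m : ℕ in atTop, ∀ C : Circuit (Fin m), C.IsOver B2 →
        (C.size : ℝ) ≤ (2 : ℝ) ^ (ε / 16 * m) →
          (2 : ℝ) ^ m ≤ (m : ℝ) ^ 6 * (Finset.univ.filter fun w : Fin m → Bool => C.eval w ≠ L₁.sliceFn m w).card) →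
      ∃ L' ∈ E, ∃ ε' : ℝ, 0 < ε' ∧
        ∀ᶠ n : ℕ in atTop, AvgHardAtLeast (L'.sliceFn n) ((2 : ℝ) ^ (ε' * n))) :
    impagliazzo_wigderson :=
  impagliazzo_wigderson_of_hardnessAmplification fun hE => hmild (HardLangM.exists_mildHard_E hE)

/-- **Impagliazzo–Wigderson 1997, Thm. 2 (= Arora–Barak 2009, Thm. 20.7 (1)): if some language in
`E = DTIME(2^{O(n)})` has circuit complexity `2^{Ω(n)}` almost everywhere, then `P = BPP`** — the
closed discharge of the named fact `impagliazzo_wigderson`. Chain: worst-case to mild average-case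
hardness in `E` (`HardLangM.exists_mildHard_E`), mild to strong average-case hardness in `E`
(`IWStrong.avgHard_strongLang` + `IWStrongM.strongLang_mem_E`, with `q = ⌈64/ε₁⌉₊ + 1`), the
Nisan–Wigderson generator (`P_eq_BPP_of_avgHard_E`). [cite: ImpagliazzoWigderson1997, Thm. 2] -/
theorem impagliazzo_wigderson_holds : impagliazzo_wigderson :=
  impagliazzo_wigderson_of_mildToStrong fun ⟨L₁, hL₁, ε₁, hε₁, hmild⟩ =>
    have hq1 : 1 ≤ ⌈64 / ε₁⌉₊ + 1 := Nat.le_add_left 1 _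
    have hqε : (64 : ℝ) ≤ ((⌈64 / ε₁⌉₊ + 1 : ℕ) : ℝ) * ε₁ := by
      have h1 : 64 / ε₁ ≤ (⌈64 / ε₁⌉₊ : ℝ) := Nat.le_ceil _
      have h2 : 64 / ε₁ * ε₁ = 64 := div_mul_cancel₀ 64 hε₁.ne'
      push_cast
      nlinarith
    ⟨IWStrong.strongLang (⌈64 / ε₁⌉₊ + 1) L₁, IWStrongM.strongLang_mem_E _ hq1 hL₁, IWStrong.epsOf (⌈64 / ε₁⌉₊ + 1),
      IWStrong.epsOf_pos _, IWStrong.avgHard_strongLang _ L₁ hq1 hqε hmild⟩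

end Literature.Computability.Complexity
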